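import Summits.ResolutionOfSingularities.ResolutionOfSingularities.Theorems.TwistCutLaw
import HarnessLib

/-!
# TwistCutCells — decomp-res node «TwistCut» (lens-6 g21, critic row 159), tree file 3/3 of the node

Content VERBATIM from the decomp-res lens-6 g21 node `HOME/decomp-res-lens-6/g21/TwistCut.lean` (pin facffb9d, 779 l;
HOME = run/shared/lean/pub/decomp-res; node farm rc 0 · 0 warn · 0 sorry · standard axioms; imports TREE ONLY:
`Theorems.SubfieldContactAbs` +
seven `Literature/AlgebraicGeometry/Resolution` modules; ONE namespace `…Theorems.TwistCutClasses`; no carried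
block).  Critic: CRITIC-LEDGER
row 159 (2026-08-31T00:42:09Z): DECIDED-MOD-PORT(M+) +1 · MAP 0 — THE TWIST LAW in kernel on a typed sub-cell of
`E1TopNoAbs` (item 26971), own
axis; the twisted-Fermat inhabitant decided; residual certificates incl. the sharp TAME near point; port
`WildPointElimination` honest bookkeeping.
Landing order INBOX :591 (critic) / NODE-g21 §6 (lens-6): `--kind proof --supports
stmt-ResolutionOfSingularities-26971`, canonical headers,
three files `TwistCutOperators` (§1–§5: the symbolic-power order law for differential operators, commutator algebra,
transport along ring isos,
coefficient operators on polynomial rings, chart algebra) · `TwistCutLaw` (§6–§7: the three algebraic steps and THE TWIST LAW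
`not_near_of_diffSplit` at scheme level) · `TwistCutCells` (§8–§9: the cells `DiffSplitAt` / `NoNearPointOver` /
`TopNonSplit` / `WORTopNonSplit` /
`WORTopOnlySplit` / `E1TopNonSplit` / `E1TopOnlySplit`, the EXACT carve `e1TopNoAbs_iff_nonSplit_onlySplit`, the
port `WildPointElimination`, the
decided chain `worTopOnlySplit_of_allAbs_of_elimination` / `e1TopNoAbs_iff_e1TopNonSplit(_of_five)` /
`e_one_of_nonSplit`, and the field-level
inhabitant certificates).  Aside bookkeeping (row 159 / INBOX :591): on the lens-6 column ONE port item
`WildPointElimination` (∀ n ≥ 1) and ONE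
successor aside `E1TopNonSplit` SUPERSEDING `E1TopNoAbs` (26971) with the mod-port reading; the decided cell
`E1TopOnlySplit` is not filed.
The lens-6 rev1 companion `TwistCutElim.lean` (868dfb91; the port discharged modulo `BaseStable` ∧
`WildSplitFinite`) awaits the critic.

## This file

§8 THE CELLS (exact re-location of the residual `E1TopNoAbs` = item 26971): `DiffSplitAt` (DEFINITION, support),
`NoNearPointOver` (DEFINITION), `noNearPointOver_of_diffSplitAt` (THE TWIST LAW for marked ideals), `TopNonSplit`
(the residual point class), **`WORTopNonSplit` / `E1TopNonSplit`** (THE RESIDUAL — the ONE successor aside on the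
lens-6 column), `WORTopOnlySplit` / `E1TopOnlySplit` (DECIDED-MOD-PORT), the EXACT hypothesis-free carves
`worTopNoAbs_iff_nonSplit_onlySplit` / **`e1TopNoAbs_iff_nonSplit_onlySplit`**, the port **`WildPointElimination
n`** (KNOWN-MOD-PORT, in the shape of lens-5's `Purification`; a `def … : Prop` family used as a hypothesis — the
ONE port item of the column as `∀ n ≥ 1, WildPointElimination n`), `worTopOnlySplit_of_allAbs_of_elimination`,
`e1TopNoAbs_iff_e1TopNonSplit` / `_of_five` (modulo `SubfieldContactAbs` PROVED + `E 5` + the port, 26971 IS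
`E1TopNonSplit`), `e_one_of_nonSplit` (summit edge `E 1`); §9 INHABITANT CERTIFICATES at field level:
`diagonalSplit_of_derivations` (decided side: `Z^p + b₁T^p + b₂U^p + b₃W^p` over `𝔽_p(b₁,b₂,b₃)` is split),
`isDiffOpLE_apply_eq_mul_of_perfect` / `not_split_of_scalar` / `not_diffSplitAt_of_scalar` (residual side: over a
perfect residue field no top point of embedding dimension `≥ 2` is split).  Cone-free (importable by the route file:
aside + port home).  Imports `TwistCutLaw`.

[WRITER NOTE (decomp-res writer g9): file split only (tree files ≤ 400 lines); namespace, universe, sections,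
section variables / opens and
every declaration exactly as in the lens; the only edits are DOCSTRING-ONLY: kind tags on `E1TopNonSplit` /
`E1TopOnlySplit` (INBOX :591), a docstring for `polyChartEquiv`, and the
lens's global dupNamespace-linter line dropped (no duplicate namespace component in the tree file names).]

(Sources: EGAIV4 16.8.2, 16.8.8; Matsumura1987 §26, Thm 30.6; Villamayor2008 Def. 3.3 (arXiv:math/0606796);
BenitoVillamayor2012 (arXiv:1004.1803); BGMW §3.1; CossartJannsenSaito2020 Def. 3.13, §4, Thm 1.4;
CossartPiltant2019; Giraud1975; Hironaka1970Additive; Moh1987.)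
-/

noncomputable section

open CategoryTheory AlgebraicGeometry TopologicalSpace IsLocalRing
open Literature.AlgebraicGeometry.Resolution

universe u

namespace Summit.ResolutionOfSingularities.ResolutionOfSingularities.Theorems.TwistCutClasses

section Cells

open Summit.ResolutionOfSingularities.ResolutionOfSingularities.Theorems
open WeakOrderReduction ForcedTowerClasses SubfieldContactClasses AbsoluteContactClasses PurityValveClasses

/-! ## §8 THE CELLS (exact re-location of the residual `E1TopNoAbs` = item 26971 `SCE1NoSubDvd` ≡ `E1TopNoAbs`):
the decided sub-cell «split» and the residual «non-split», sequence form -/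

/-- **`DiffSplitAt 𝓘 n y` — THE POINT IS DIFFERENTIALLY SPLIT** (NEW sub-cell predicate of lens-6, twist axis): for some
regular system of parameters `c` of `𝒪_{Y,y}` (`|c| = edim`), some `f ∈ 𝓘_y` and some degree-`n` form
`Σ_{e ∈ E} a_e c^e ≡ f (mod 𝔪_y^{n+1})` indexing all pure powers `cᵢ^n`, the RESIDUE coefficient vector `(ā_e)_e ∈ κ(y)^E` is
split by ABSOLUTE differential operators OF THE RESIDUE FIELD of order `≤ n − 1`: `∀ i ∃ δᵢ ∈ Diff^{≤n−1}_ℤ(κ(y))` with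
`δᵢ(ā_e) = [e = n·εᵢ]`.  Empty over perfect residue fields in embedding dimension `≥ 2` (`not_diffSplitAt_of_scalar`): it
measures the TWIST of the `p`-power form against the imperfection of `κ(y)`. DEFINITION (support). -/
def DiffSplitAt {Y : Scheme.{0}} (I : Y.IdealSheafData) (n : ℕ) (y : Y) : Prop :=
  ∃ (d : ℕ) (c : Fin d → Y.presheaf.stalk y),
    (maximalIdeal (Y.presheaf.stalk y)).spanFinrank = d ∧ Ideal.span (Set.range c) = maximalIdeal (Y.presheaf.stalk y) ∧
    ∃ f ∈ stalkIdeal I y, ∃ (E : Finset (Fin d → ℕ)) (a : (Fin d → ℕ) → Y.presheaf.stalk y),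
      (∀ e ∈ E, ∑ j, e j = n) ∧ (∀ i, Pi.single i n ∈ E) ∧
      f - ∑ e ∈ E, a e * ∏ j, c j ^ e j ∈ maximalIdeal (Y.presheaf.stalk y) ^ (n + 1) ∧
      ∀ i : Fin d, ∃ δ : ResidueField (Y.presheaf.stalk y) →ₗ[ℤ] ResidueField (Y.presheaf.stalk y),
        IsDiffOpLE ℤ (n - 1) δ ∧ ∀ e ∈ E, δ (residue _ (a e)) = if e = Pi.single i n then 1 else 0

/-- **`NoNearPointOver M y`** — blowing up the (reduced, regular) point `y` leaves NO point of the transformed marked ideal's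
support over `y` (no «near point», CossartJannsenSaito2020 Def. 3.13). DEFINITION (support). -/
def NoNearPointOver {Y : Scheme.{0}} (M : MarkedIdeal Y) (y : Y) : Prop :=
  ∀ (C : Y.IdealSheafData) (Y' : Scheme.{0}) (π : Y' ⟶ Y), (C.support : Set Y) = {y} →
    Scheme.IsRegular C.subscheme → IsBlowup π C → ∀ y' : Y', π.base y' = y → y' ∉ (M.transform π C).support

/-- **KERNEL (PROVED, every characteristic, every field): SPLIT ⟹ NO NEAR POINT** — the twist law at the level of
marked ideals. [new] [folklore] -/
theorem noNearPointOver_of_diffSplitAt {Y : Scheme.{0}} (hY : Scheme.IsRegular Y) {n : ℕ} (hn : 1 ≤ n)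
    (M : MarkedIdeal Y) (hM : M.mult = n) {y : Y} (hyc : IsClosed ({y} : Set Y)) (hs : DiffSplitAt M.ideal n y) :
    NoNearPointOver M y := by
  intro C Y' π hpt hCreg hπ y' hy' hmem
  subst hy'
  obtain ⟨d, c, hd, hc, f, hfI, E, a, hE, hEi, hfa, hsplit⟩ := hs
  rw [MarkedIdeal.mem_support_iff, MarkedIdeal.transform_ideal, MarkedIdeal.transform_mult, hM] at hmem
  exact not_near_of_diffSplit hπ hY hCreg M.ideal y' hyc hpt c hd hc hn hfI E hE a hfa hEi hsplit hmem

/-- **`TopNonSplit Y 𝓘 n` — THE RESIDUAL POINT CLASS**: a CLOSED top point WITHOUT absolute stalk contact which is NOT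
differentially split. DEFINITION (located residual's point class). -/
def TopNonSplit (Y : Scheme.{0}) (I : Y.IdealSheafData) (n : ℕ) : Prop :=
  ∃ y : Y, IsClosed ({y} : Set Y) ∧ idealOrder I y = ((n : ℕ) : ℕ∞) ∧ ¬ IsAbsContactAt I n y ∧ ¬ DiffSplitAt I n y

/-- A non-split wild top point is a wild top point. [trivial] [folklore] -/
theorem topNoAbsContact_of_topNonSplit {Y : Scheme.{0}} {I : Y.IdealSheafData} {n : ℕ} (h : TopNonSplit Y I n) :
    TopNoAbsContact Y I n := by
  obtain ⟨y, hyc, hord, hna, -⟩ := h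
  exact ⟨y, hyc, hord, hna⟩

/-- **THE RESIDUAL · `WORTopNonSplit n`** — weak order reduction at marking `n` (dim ≤ 4, any field, any boundary) for the
data having a closed top point without absolute stalk contact which is NOT differentially split. DEFINITION (located
residual). -/
def WORTopNonSplit (n : ℕ) : Prop :=
  ∀ p : ℕ, p.Prime → ∀ (k : Type) [Field k] [CharP k p] (Y : Scheme.{0}) (g : Y ⟶ Spec (.of k)),
    IsBase Y g → ∀ M : MarkedIdeal Y, IsDatum n M → TopNonSplit Y M.ideal n →
      ∃ t : CentreSeq Y, WeakResolution t M

/-- **THE DECIDED SUB-CELL · `WORTopOnlySplit n`** — the data having closed top points without absolute stalk contact,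
ALL OF WHICH are differentially split. DEFINITION (decided cell). -/
def WORTopOnlySplit (n : ℕ) : Prop :=
  ∀ p : ℕ, p.Prime → ∀ (k : Type) [Field k] [CharP k p] (Y : Scheme.{0}) (g : Y ⟶ Spec (.of k)),
    IsBase Y g → ∀ M : MarkedIdeal Y, IsDatum n M → TopNoAbsContact Y M.ideal n → ¬ TopNonSplit Y M.ideal n →
      ∃ t : CentreSeq Y, WeakResolution t M

/-- **THE RESIDUAL (family) · `E1TopNonSplit`** — `WORTopNonSplit n` at every marking `n ≥ 1`: THE LOCATED RESIDUAL
of the lens-6 column after g21, the ONE successor aside superseding `E1TopNoAbs` (item 26971, `SCE1NoSubDvd` ≡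
`E1TopNoAbs` modulo `SubfieldContactAbs`): EXACT carve `e1TopNoAbs_iff_nonSplit_onlySplit` (hypothesis-free), and
modulo `SubfieldContactAbs` (PROVED, g20), `E 5` and the port `WildPointElimination` it IS `E1TopNoAbs`
(`e1TopNoAbs_iff_e1TopNonSplit_of_five`). RESIDUAL. -/
def E1TopNonSplit : Prop := ∀ n : ℕ, 1 ≤ n → WORTopNonSplit n

/-- **THE DECIDED-MOD-PORT family · `E1TopOnlySplit`** — `WORTopOnlySplit n` at every marking `n ≥ 1`; DECIDED
modulo the tame side `E1AllAbs` (⟸ `SubfieldContactAbs ∧ E 5`, tree `worAllAbs_of_five`) and the port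
`WildPointElimination` (`worTopOnlySplit_of_allAbs_of_elimination`). DECIDED-MOD-PORT. -/
def E1TopOnlySplit : Prop := ∀ n : ℕ, 1 ≤ n → WORTopOnlySplit n

/-- **EXACT CARVE at one marking**: `WORTopNoAbs n ⟺ WORTopNonSplit n ∧ WORTopOnlySplit n` (excluded middle on
`TopNonSplit`). [folklore] -/
theorem worTopNoAbs_iff_nonSplit_onlySplit (n : ℕ) : WORTopNoAbs n ↔ WORTopNonSplit n ∧ WORTopOnlySplit n := by
  constructor
  · intro h
    exact ⟨fun p hp k _ _ Y g hB M hM hns => h p hp k Y g hB M hM (topNoAbsContact_of_topNonSplit hns),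
      fun p hp k _ _ Y g hB M hM htop _ => h p hp k Y g hB M hM htop⟩
  · rintro ⟨hN, hO⟩ p hp k _ _ Y g hB M hM htop
    by_cases hns : TopNonSplit Y M.ideal n
    · exact hN p hp k Y g hB M hM hns
    · exact hO p hp k Y g hB M hM htop hns

/-- **EXACT CARVE of the family**: `E1TopNoAbs ⟺ E1TopNonSplit ∧ E1TopOnlySplit`. [folklore] -/
theorem e1TopNoAbs_iff_nonSplit_onlySplit : E1TopNoAbs ↔ E1TopNonSplit ∧ E1TopOnlySplit := by
  constructor
  · intro h
    exact ⟨fun n hn => ((worTopNoAbs_iff_nonSplit_onlySplit n).1 (h n hn)).1,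
      fun n hn => ((worTopNoAbs_iff_nonSplit_onlySplit n).1 (h n hn)).2⟩
  · rintro ⟨hN, hO⟩ n hn
    exact (worTopNoAbs_iff_nonSplit_onlySplit n).2 ⟨hN n hn, hO n hn⟩

/-- **port · `WildPointElimination n`** (KNOWN-MOD-PORT, in the shape of lens-5's `Purification`; BGMW §3.1 /
CossartJannsenSaito2020 §4 bookkeeping): a datum each of whose closed top points WITHOUT absolute stalk contact has NO NEAR
POINT under its point blow-up admits a weakly admissible sequence (the blow-ups of these finitely many isolated points of
the top locus) whose transform is again a base datum at marking `n` and has NO closed top point without absolute contact.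
Proof obligations (standard, no new idea): a no-near top point is an isolated point of the closed top locus (`π` proper +
closedness of the support), the isolated points of a closed subset of a noetherian space are finitely many, off-centre
invariance of `idealOrder` / `IsAbsContactAt` / closedness (tree `IsBlowup.isIso_stalkMap_of_not_mem_support`), the reduced
closed point is a regular centre inside the support, and `BaseStable`. -/
def WildPointElimination (n : ℕ) : Prop :=
  ∀ p : ℕ, p.Prime → ∀ (k : Type) [Field k] [CharP k p] (Y : Scheme.{0}) (g : Y ⟶ Spec (.of k)),
    IsBase Y g → ∀ M : MarkedIdeal Y, IsDatum n M →
      (∀ y : Y, IsClosed ({y} : Set Y) → idealOrder M.ideal y = ((n : ℕ) : ℕ∞) → ¬ IsAbsContactAt M.ideal n y →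
        NoNearPointOver M y) →
      ∃ t : CentreSeq Y, WeakAdmissible t M ∧ ∃ _ : IsBase t.top (t.comp ≫ g),
        IsDatum n (t.transformMarked M) ∧ ¬ TopNoAbsContact t.top (t.transformMarked M).ideal n

/-- **THE DECIDED CELL (PROVED modulo the tame side `WORAllAbs n` and the port)**: `WORTopOnlySplit n`.  The twist law
supplies `NoNearPointOver` at every wild closed top point of a datum of the cell; the port eliminates them; the tame engine
resolves the transform; the sequences compose (`weakResolution_seqAppend`). [new] [folklore] -/
theorem worTopOnlySplit_of_allAbs_of_elimination {n : ℕ} (hn : 1 ≤ n) (hA : WORAllAbs n)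
    (hW : WildPointElimination n) : WORTopOnlySplit n := by
  intro p hp k _ _ Y g hB M hM _ hns
  obtain ⟨t, hadm, hB', hM', hno⟩ := hW p hp k Y g hB M hM fun y hyc hord hna => by
    have hsplit : DiffSplitAt M.ideal n y := by
      by_contra h
      exact hns ⟨y, hyc, hord, hna, h⟩
    exact noNearPointOver_of_diffSplitAt hB.isRegular hn M hM.1 hyc hsplit
  obtain ⟨t', ht'⟩ := hA p hp k t.top (t.comp ≫ g) hB' (t.transformMarked M) hM' hno
  exact ⟨seqAppend t t', weakResolution_seqAppend t t' M hadm ht'⟩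

/-- **THE RE-LOCATION (family level)**: modulo the tame side `E1AllAbs` (⟸ `SubfieldContactAbs ∧ E 5`, tree
`worAllAbs_of_five`, `SubfieldContactAbs` PROVED in g20) and the port, the located residual `E1TopNoAbs` (item 26971) IS the
smaller residual `E1TopNonSplit`. [new] [folklore] -/
theorem e1TopNoAbs_iff_e1TopNonSplit (hA : E1AllAbs) (hW : ∀ n : ℕ, 1 ≤ n → WildPointElimination n) :
    E1TopNoAbs ↔ E1TopNonSplit := by
  rw [e1TopNoAbs_iff_nonSplit_onlySplit]
  exact ⟨fun h => h.1, fun h => ⟨h, fun n hn => worTopOnlySplit_of_allAbs_of_elimination hn (hA n hn) (hW n hn)⟩⟩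

/-- The same with the tame side discharged by the tree's engines: `SubfieldContactAbs` (g20, PROVED) and `E 5`.
[new] [folklore] -/
theorem e1TopNoAbs_iff_e1TopNonSplit_of_five (hSC : SubfieldContactAbs) (h5 : E 5)
    (hW : ∀ n : ℕ, 1 ≤ n → WildPointElimination n) : E1TopNoAbs ↔ E1TopNonSplit :=
  e1TopNoAbs_iff_e1TopNonSplit (fun n hn => worAllAbs_of_five hSC hn (h5 n hn)) hW

/-- **Summit edge**: `E 1` (≡ the root modulo the accepted ports, tree `wor_iff_seqDimFour_one`) follows from the tame
engine `E 5`, the residual `E1TopNonSplit` and the port. [new] [folklore] -/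
theorem e_one_of_nonSplit (hSC : SubfieldContactAbs) (h5 : E 5) (hW : ∀ n : ℕ, 1 ≤ n → WildPointElimination n)
    (hR : E1TopNonSplit) : E 1 :=
  (e_one_iff_topNoAbs hSC h5).2 ((e1TopNoAbs_iff_e1TopNonSplit_of_five hSC h5 hW).2 hR)

end Cells

section Certificates

variable {K : Type*}

/-! ## §9 INHABITANT CERTIFICATES (field level): split coefficient vectors from derivations of an imperfect residue field;
no split vector over a differentially trivial (e.g. perfect) residue field -/

/-- **DECIDED-SIDE CERTIFICATE**: a DIAGONAL coefficient vector `(ā_i)_i` with `ā_{i₀} = 1` whose other entries admit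
«partial derivations» `D_l` (`D_l ā_m = [l = m]`, `l, m ≠ i₀`) is differentially split at every order cap `≥ 1`:
`δ_{i₀} = id − Σ_{l ≠ i₀} ā_l D_l`, `δ_l = D_l`.  Instance: `κ = 𝔽_p(b₁, b₂, b₃)`, `ā = (1, b₁, b₂, b₃)`, `D_l = ∂/∂b_l`
— the initial form `Z^p + b₁T^p + b₂U^p + b₃W^p` on `𝔸⁴_κ`. [new; elementary] [folklore] -/
theorem diagonalSplit_of_derivations [CommRing K] {d m : ℕ} (hm : 1 ≤ m) (i₀ : Fin d) (ab : Fin d → K) (h0 : ab i₀ = 1)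
    (D : Fin d → Derivation ℤ K K) (hD : ∀ l m' : Fin d, l ≠ i₀ → m' ≠ i₀ → D l (ab m') = if l = m' then 1 else 0) :
    ∀ i : Fin d, ∃ δ : K →ₗ[ℤ] K, IsDiffOpLE ℤ m δ ∧ ∀ j : Fin d, δ (ab j) = if j = i then 1 else 0 := by
  classical
  intro i
  by_cases hi : i = i₀
  · subst hi
    refine ⟨LinearMap.id - ∑ l ∈ Finset.univ.erase i, ab l • ((D l : K →ₗ[ℤ] K)), ?_, fun j => ?_⟩
    · refine IsDiffOpLE.sub (IsDiffOpLE.of_le (Nat.zero_le m) isDiffOpLE_id) (IsDiffOpLE.sum _ fun l _ => ?_)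
      exact IsDiffOpLE.smul _ (IsDiffOpLE.of_le hm (Derivation.isDiffOpLE_one (D l)))
    · simp only [LinearMap.sub_apply, LinearMap.id_apply, LinearMap.coe_sum, Finset.sum_apply, LinearMap.smul_apply,
        Derivation.coeFn_coe, smul_eq_mul]
      by_cases hj : j = i
      · subst hj
        rw [if_pos rfl, h0, sub_eq_self]
        exact Finset.sum_eq_zero fun l _ => by rw [Derivation.map_one_eq_zero, mul_zero]
      · rw [if_neg hj, Finset.sum_eq_single_of_mem j (Finset.mem_erase.mpr ⟨hj, Finset.mem_univ j⟩)
          fun l hl hlj => by rw [hD l j (Finset.mem_erase.mp hl).1 hj, if_neg hlj, mul_zero],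
          hD j j hj hj, if_pos rfl, mul_one, sub_self]
  · refine ⟨(D i : K →ₗ[ℤ] K), IsDiffOpLE.of_le hm (Derivation.isDiffOpLE_one (D i)), fun j => ?_⟩
    rw [Derivation.coeFn_coe]
    by_cases hj : j = i₀
    · subst hj
      rw [h0, Derivation.map_one_eq_zero, if_neg (Ne.symm hi)]
    · rw [hD i j hi hj]
      by_cases hji : j = i
      · rw [if_pos hji.symm, if_pos hji]
      · rw [if_neg (Ne.symm hji), if_neg hji]

/-- **RESIDUAL-SIDE CERTIFICATE (i): over a PERFECT field of characteristic `p` every absolute differential operator of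
finite order is a multiplication** (`δ = δ(1)·`): `δ − δ(1)·` is inductively a derivation, and derivations of a perfect field
vanish (`D(b^p) = p b^{p−1} D b = 0`).  Hence NO coefficient vector is split there in embedding dimension `≥ 2`: the whole
perfect-ground-field wild world (lens-4's data at `k`-rational points, every closed point over a perfect field) lies in the
residual `TopNonSplit`. [folklore; EGAIV4 §16.8 / Matsumura1987 §26] [folklore] -/
theorem isDiffOpLE_apply_eq_mul_of_perfect [Field K] (p : ℕ) [Fact p.Prime] [CharP K p]
    (hperf : ∀ a : K, ∃ b : K, b ^ p = a) :
    ∀ (m : ℕ) (δ : K →ₗ[ℤ] K), IsDiffOpLE ℤ m δ → ∀ x : K, δ x = x * δ 1 := by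
  intro m
  induction m with
  | zero =>
    intro δ hδ x
    rw [isDiffOpLE_zero_iff_eq_mulLeft.mp hδ, LinearMap.mulLeft_apply, LinearMap.mulLeft_apply, mul_one, mul_comm]
  | succ m ih =>
    intro δ hδ
    -- `D x := δ x - x δ 1` is a derivation
    have hcomm : ∀ a b : K, δ (a * b) - a * δ b = b * (δ a - a * δ 1) := fun a b => by
      have h1 := ih (commMul ℤ δ a) (hδ a) b
      simp only [commMul_apply, mul_one] at h1
      rw [h1]
    have hleib : ∀ a b : K, δ (a * b) - a * b * δ 1 = a * (δ b - b * δ 1) + b * (δ a - a * δ 1) := fun a b => by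
      have := hcomm a b
      linear_combination this
    have hpow : ∀ (b : K) (k : ℕ), δ (b ^ (k + 1)) - b ^ (k + 1) * δ 1 = (k + 1 : ℕ) * b ^ k * (δ b - b * δ 1) := by
      intro b k
      induction k with
      | zero => simp
      | succ k ihk =>
        have := hleib b (b ^ (k + 1))
        rw [← pow_succ'] at this
        rw [this, ihk]
        push_cast
        ring
    intro x
    obtain ⟨b, rfl⟩ := hperf x
    have hp1 : p = (p - 1) + 1 := (Nat.sub_add_cancel (Fact.out : p.Prime).one_le).symm
    have h := hpow b (p - 1)
    rw [← hp1, CharP.cast_eq_zero K p, zero_mul, zero_mul, sub_eq_zero] at h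
    exact h

/-- **RESIDUAL-SIDE CERTIFICATE (ii): no split coefficient vector over a differentially trivial field in embedding
dimension `≥ 2`** (two distinct pure powers cannot both be isolated by multiplications). [new; elementary] [folklore] -/
theorem not_split_of_scalar [Field K] {m d n : ℕ} (hsc : ∀ δ : K →ₗ[ℤ] K, IsDiffOpLE ℤ m δ → ∀ x : K, δ x = x * δ 1)
    {i j : Fin d} (hij : i ≠ j) (hn : n ≠ 0) (E : Finset (Fin d → ℕ)) (hEi : Pi.single i n ∈ E)
    (hEj : Pi.single j n ∈ E) (ab : (Fin d → ℕ) → K)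
    (h : ∀ l : Fin d, ∃ δ : K →ₗ[ℤ] K, IsDiffOpLE ℤ m δ ∧ ∀ e ∈ E, δ (ab e) = if e = Pi.single l n then 1 else 0) :
    False := by
  have hne : Pi.single j n ≠ (Pi.single i n : Fin d → ℕ) := fun heq => by
    have := congrFun heq j
    rw [Pi.single_eq_same, Pi.single_eq_of_ne (Ne.symm hij)] at this
    exact hn this
  obtain ⟨δi, hδi, hδiE⟩ := h i
  obtain ⟨δj, hδj, hδjE⟩ := h j
  have h1 : ab (Pi.single i n) * δi 1 = 1 := by rw [← hsc δi hδi, hδiE _ hEi, if_pos rfl]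
  have h2 : ab (Pi.single j n) * δi 1 = 0 := by rw [← hsc δi hδi, hδiE _ hEj, if_neg hne]
  have h3 : ab (Pi.single j n) * δj 1 = 1 := by rw [← hsc δj hδj, hδjE _ hEj, if_pos rfl]
  have hδi1 : δi 1 ≠ 0 := fun h0 => by rw [h0, mul_zero] at h1; exact zero_ne_one h1
  have hab : ab (Pi.single j n) = 0 := (mul_eq_zero.mp h2).resolve_right hδi1
  rw [hab, zero_mul] at h3
  exact zero_ne_one h3

open Summit.ResolutionOfSingularities.ResolutionOfSingularities.Theorems in
/-- **RESIDUAL-SIDE CERTIFICATE (iii, point level)**: at a point of embedding dimension `≥ 2` whose residue field is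
differentially trivial up to order `n − 1` (e.g. perfect of characteristic `p`, certificate (i)), NO datum is differentially
split: such wild top points all lie in `TopNonSplit`. [new; elementary] [folklore] -/
theorem not_diffSplitAt_of_scalar {Y : Scheme.{0}} (I : Y.IdealSheafData) {n : ℕ} (hn : 1 ≤ n) (y : Y)
    (hdim : 2 ≤ (maximalIdeal (Y.presheaf.stalk y)).spanFinrank)
    (hsc : ∀ δ : ResidueField (Y.presheaf.stalk y) →ₗ[ℤ] ResidueField (Y.presheaf.stalk y),
      IsDiffOpLE ℤ (n - 1) δ → ∀ x, δ x = x * δ 1) : ¬ DiffSplitAt I n y := by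
  rintro ⟨d, c, hd, hc, f, hfI, E, a, hE, hEi, hfa, hsplit⟩
  rw [hd] at hdim
  exact not_split_of_scalar hsc (i := ⟨0, by omega⟩) (j := ⟨1, by omega⟩) (fun h => by simp [Fin.ext_iff] at h)
    (by omega) E (hEi _) (hEi _) (fun e => residue _ (a e)) hsplit

end Certificates

end Summit.ResolutionOfSingularities.ResolutionOfSingularities.Theorems.TwistCutClasses
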